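import Literature.MathematicalPhysics.QuantumFieldTheory.Balaban1983to89.B6GradLegKLevelV1
import Literature.MathematicalPhysics.QuantumFieldTheory.Balaban1983to89.B6BlockHolderLipschitzV1
import Literature.MathematicalPhysics.QuantumFieldTheory.Balaban1983to89.B6Partition118KLevelFineMixed

/-!
# `Balaban1983to89.B6HBDisplacementLipV1` — T. Bałaban, *Propagators and renormalization transformations for lattice gauge theories. II*,
# Commun. Math. Phys. **96** (1984) 223–250 [Balaban1984PropagatorsII], Prop. 2.6 (2.137) p. 247 with (2.92) p. 239 line 1: THE SIZES OF `h_□`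
# AND `∇_νh_□` ALONG A LATTICE DISPLACEMENT ON THE V1 GLOBAL TORUS — for two fine bonds `x, x′` of the same direction,
# **`|h_□(x) − h_□(x′)| ≤ (d+1)|x − x′|_∞·C1F/(8S_□/5)`** and **`|(∇^η_νh_□)(x) − (∇^η_νh_□)(x′)| ≤ |c′|(d+1)|x − x′|_∞·C2X/(8S_□/5)²`**
# (`S_□ = M_hL^{j(□)+1}` fine sites): print's `|∂h_□| ≤ O(1)(ML^jη)^{−1}`, `|∂∂′h_□| ≤ O(1)(ML^jη)^{−2}` integrated along the staircase from `x′` to `x`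
# — the `h_□`-inputs of the Hölder estimate (2.137) of the first leg `∇_ν(h_□G_□h_□)` of (2.141) at a PAIR of points

statement-level skeleton of published theorems with citation tags; proofs where landed; nothing here is a claim about the Yang–Mills mass gap

PDF held: `paper:balaban1984-cmp96-propagators-rt-ii` (journal page = PDF page + 222): p. 239 [PDF 17], p. 247 [PDF 25].  PRINT p. 247 (2.137)
*"‖ζ∇GJ‖_α ≤ O(1)(Lʲη)^{1−α}(‖ζ‖_α + |ζ|)e^{−δ₃d(y,y′)}|J|"* obtained *"reasoning in the same way as in the proof of Proposition 2.2"*, i.e. through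
(2.141) `G = Σ_ω h G_□ h K ⋯`, whose first leg differenced at `x, x′` is `∇_ν(h_□G_□h_□) = (S_νh_□)·∇_ν(G_□h_□) + (∇_νh_□)·(G_□h_□)` ((2.92) line 1,
p38's `…B6GradLegKLevelV1.DV_sandwich_eq`); the pair difference of each product needs `h_□(x⁺) − h_□(x′⁺)` and `(∇_νh_□)(x) − (∇_νh_□)(x′)`, which THIS
FILE bounds by the number of unit steps `≤ (d+1)|x − x′|_∞` (p38's staircase `…B6BlockHolderLipschitzV1.pseudoDist_le_path`) times the unit-step sizes:
p38's `abs_hB_shift_sub_le` (`C1F/(8S/5)`) and, for `∇_νh_□`, the pure-or-mixed second difference `abs_hT_diff_step_le` of `…B6Partition118KLevelFineMixed`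
(`C2X/(8S/5)²`) read on the V1 torus (§1).

CITATION HEADER (lean-in-tree rule) — WHAT IS REPRODUCED.  Phase-2 file of the `lit-balaban` typed skeleton (HOME `run/shared/lean/pub/lit-balaban/`), seat
**p22 gen 26**, free-target (2.137)₁ at k levels (HOME/STATUS TAKING 2026-08-23T22:15Z; r03 NO OBJECTION 22:25Z); SKELETON row **B6.Prop2.6** (cells only;
decls of record untouched).  §1 `abs_hB_shift_shift_le` (the unit step of `∇_νh_□` on the V1 torus: `toBox_shift` twice into `abs_hT_diff_step_le`);
§2 **`abs_hB_sub_le_supDist`**; §3 **`abs_DV_hB_sub_le_supDist`**.  Theorems only; no definition, no `def … : Prop`; standard axioms.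
HONEST SCOPE. Constants `d`-, `L`-dependent (`C1F`, `C2X`), not optimised; `|x − x′|_∞` is the torus sup-distance `supDist` of the initial points (same
direction); nothing on d = 4 or the continuum; NOT summit progress.  Unit `lit-balaban-p22` (gen 26), 2026-08-23.
-/

namespace Literature.MathematicalPhysics.QuantumFieldTheory.Balaban1983to89.B6HBDisplacementLipV1

open Finset
open LatticeFieldCalculus
open B4Sect5Torus (IsPseudoDist)
open B6MultiLevelBoxOperator (N0 bigSide one_le_bigSide)
open B6MultiLevelTorusOperator (TDomains tshift unitVec)
open B6Cover236MultiLevelBlocks (cubes)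
open B6GlobalChartV1 (PV toBox)
open B6ScalarChartV1 (toBox_shift)
open B6Partition118KLevelFineSizes (C1F C1F_nonneg)
open B6Partition118KLevelFineMixed (C2X C2X_bounds abs_hT_diff_step_le)
open B6Prop26KLevelSkeletonV1 (hB hB_apply)
open B6GradLegKLevelV1 (DV DV_apply abs_hB_shift_sub_le)
open B6BlockHolderLipschitzV1 (pseudoDist_le_path)
open B6CubeCoeffSizesV1 (one_le_ell)

variable {d ℓ : ℕ} {hd : 1 ≤ d + 1} {hL : Odd (ℓ + 1) ∧ 1 < ℓ + 1} {m K : ℕ} {Mh k R : ℕ} {P' : Fin (d + 1) → ℕ}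
variable (hN : ∀ μ, N0 ℓ Mh k P' μ = (PV d ℓ m K hd hL).sitesPerDir 0) (D : TDomains d ℓ Mh k P' R) (c : ↥(cubes D.toDomains))

/-! ## §1  The unit step of `∇_νh_□` on the V1 torus -/

/-- **THE UNIT STEP OF A FIRST DIFFERENCE OF `h_□` ON THE V1 TORUS**, any two axes `μ, ν`:
`|h_□(b + e_μ + e_ν) − h_□(b + e_μ) − h_□(b + e_ν) + h_□(b)| ≤ C2X/(8S/5)²`, `S = M_h·L^{j(□)+1}` («|∂∂′h_□| ≤ O(1)(ML^jη)^{−2}», pure or mixed).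
[cite: Balaban1984PropagatorsII, p.247 (2.137) / after (2.134), (2.92) p.239 line 1; Balaban1983RegularityDecay, §2 p.577] -/
theorem abs_hB_shift_shift_le (hMh : 2 ≤ Mh) (hR : 2 * (ℓ + 1) ≤ R) (hP5 : ∀ μ, 5 ≤ P' μ) (μ ν : Fin (d + 1))
    (b : PBond (PV d ℓ m K hd hL) 0) :
    |hB hN D c ⟨(b.src.shift μ).shift ν, b.dir⟩ - hB hN D c ⟨b.src.shift μ, b.dir⟩ - hB hN D c ⟨b.src.shift ν, b.dir⟩ + hB hN D c b| ≤
      C2X d ℓ / (8 / 5 * (bigSide ℓ Mh c.1.1 : ℝ)) ^ 2 := by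
  simp only [hB_apply, toBox_shift hN]
  exact abs_hT_diff_step_le (one_le_ell hL) hMh hR hP5 c μ ν (toBox hN b.src)

/-! ## §2  `h_□` along a displacement -/

/-- **`|h_□(x) − h_□(x′)| ≤ (d+1)·|x − x′|_∞·C1F/(8S/5)`** for fine bonds of the same direction («|∂h_□| ≤ O(1)(ML^jη)^{−1}» along the staircase
from `x′` to `x`). [cite: Balaban1984PropagatorsII, p.247 (2.137) / (2.92) p.239 line 1; Balaban1984PropagatorsI, (1.7) p.18 (staircase contours)] -/
theorem abs_hB_sub_le_supDist (hMh : 2 ≤ Mh) (hR : 2 * (ℓ + 1) ≤ R) (hP5 : ∀ μ, 5 ≤ P' μ) {x x' : PBond (PV d ℓ m K hd hL) 0}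
    (hdir : x.dir = x'.dir) :
    |hB hN D c x - hB hN D c x'| ≤
      ((d : ℝ) + 1) * ((supDist x.src x'.src : ℕ) : ℝ) * (C1F d ℓ / (8 / 5 * (bigSide ℓ Mh c.1.1 : ℝ))) := by
  obtain ⟨xs, δ⟩ := x
  obtain ⟨xs', δ'⟩ := x'
  simp only at hdir
  subst hdir
  set S : Site (PV d ℓ m K hd hL) 0 → Site (PV d ℓ m K hd hL) 0 → ℝ := fun p q => |hB hN D c ⟨p, δ⟩ - hB hN D c ⟨q, δ⟩| with hS
  have hPD : IsPseudoDist S :=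
    { symm := fun p q => abs_sub_comm _ _
      zero := fun p => by simp [hS]
      triangle := fun p q r => abs_sub_le _ _ _ }
  have hB0 : 0 ≤ C1F d ℓ / (8 / 5 * (bigSide ℓ Mh c.1.1 : ℝ)) := div_nonneg (C1F_nonneg d ℓ) (by positivity)
  have hPd : ((PV d ℓ m K hd hL).d : ℝ) = (d : ℝ) + 1 := by rw [show (PV d ℓ m K hd hL).d = d + 1 from rfl]; push_cast; ring
  have key := pseudoDist_le_path hPD xs xs' hB0 fun p μ' _ => by
    show |hB hN D c ⟨p, δ⟩ - hB hN D c ⟨p.shift μ', δ⟩| ≤ _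
    rw [abs_sub_comm]
    exact abs_hB_shift_sub_le hN c hMh hR hP5 μ' ⟨p, δ⟩
  rw [hPd] at key
  simpa [hS] using key

/-! ## §3  `∇_νh_□` along a displacement -/

/-- **`|(∇^η_νh_□)(x) − (∇^η_νh_□)(x′)| ≤ |c′|·(d+1)·|x − x′|_∞·C2X/(8S/5)²`** for fine bonds of the same direction, `∇^η_ν = c′(S_ν − 1)`: each unit step
of the staircase changes `∇_νh_□` by a pure or mixed second difference («|∂∂′h_□| ≤ O(1)(ML^jη)^{−2}»).
[cite: Balaban1984PropagatorsII, p.247 (2.137) / (2.92) p.239 line 1; Balaban1984PropagatorsI, (1.4), (1.7) p.18] -/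
theorem abs_DV_hB_sub_le_supDist (hMh : 2 ≤ Mh) (hR : 2 * (ℓ + 1) ≤ R) (hP5 : ∀ μ, 5 ≤ P' μ) (ν : Fin (d + 1)) (cf : ℝ)
    {x x' : PBond (PV d ℓ m K hd hL) 0} (hdir : x.dir = x'.dir) :
    |DV ν cf (hB hN D c) x - DV ν cf (hB hN D c) x'| ≤
      |cf| * (((d : ℝ) + 1) * ((supDist x.src x'.src : ℕ) : ℝ) * (C2X d ℓ / (8 / 5 * (bigSide ℓ Mh c.1.1 : ℝ)) ^ 2)) := by
  obtain ⟨xs, δ⟩ := x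
  obtain ⟨xs', δ'⟩ := x'
  simp only at hdir
  subst hdir
  set f : Site (PV d ℓ m K hd hL) 0 → ℝ := fun p => hB hN D c ⟨p.shift ν, δ⟩ - hB hN D c ⟨p, δ⟩ with hf
  set S : Site (PV d ℓ m K hd hL) 0 → Site (PV d ℓ m K hd hL) 0 → ℝ := fun p q => |f p - f q| with hS
  have hPD : IsPseudoDist S :=
    { symm := fun p q => abs_sub_comm _ _
      zero := fun p => by simp [hS]
      triangle := fun p q r => abs_sub_le _ _ _ }
  have hB0 : 0 ≤ C2X d ℓ / (8 / 5 * (bigSide ℓ Mh c.1.1 : ℝ)) ^ 2 := div_nonneg (C2X_bounds d ℓ).2.2 (by positivity)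
  have hPd : ((PV d ℓ m K hd hL).d : ℝ) = (d : ℝ) + 1 := by rw [show (PV d ℓ m K hd hL).d = d + 1 from rfl]; push_cast; ring
  have key := pseudoDist_le_path hPD xs xs' hB0 fun p μ' _ => by
    show |f p - f (p.shift μ')| ≤ _
    have h := abs_hB_shift_shift_le hN D c hMh hR hP5 μ' ν ⟨p, δ⟩
    rw [abs_sub_comm]
    have e : f (p.shift μ') - f p =
        hB hN D c ⟨(p.shift μ').shift ν, δ⟩ - hB hN D c ⟨p.shift μ', δ⟩ - hB hN D c ⟨p.shift ν, δ⟩ + hB hN D c ⟨p, δ⟩ := by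
      simp only [hf]; ring
    rw [e]; exact h
  rw [hPd] at key
  have ex : DV ν cf (hB hN D c) ⟨xs, δ⟩ - DV ν cf (hB hN D c) ⟨xs', δ⟩ = cf * (f xs - f xs') := by
    rw [DV_apply, DV_apply]; simp only [hf]; ring
  rw [ex, abs_mul]
  exact mul_le_mul_of_nonneg_left (by simpa [hS] using key) (abs_nonneg _)

end Literature.MathematicalPhysics.QuantumFieldTheory.Balaban1983to89.B6HBDisplacementLipV1
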